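import Summits.AtomisticToContinuum.FouriersLaw.Theorems.PhononMeanFreePathDefs
import Summits.AtomisticToContinuum.FouriersLaw.Theorems.PhononMeanFreePathCoherentDephasingCrossCorrelationContinuity

/-!
# Crux `PhononMeanFreePath.CoherentDephasing`, line `Sketch`: fixed-`N` regularity of the coherent response field

Stub `stub_responseRegularity` of the lead skeleton of line `Sketch` (coherent-field Beer–Lambert) of the crux
`PhononMeanFreePath.CoherentDephasing` (stmt-AtomisticToContinuum-11810). For the `(N+1)`-site chain
`P = pinnedChain ω₂ lam β γ` (`ω₂, lam, β, γ > 0`) with both Langevin baths at `T > 0`, Gibbs law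
`μ₀ = P.gibbsMeasure (N+1) T` and the constructed kernels `K_t = P.transitionKernel (N+1) T T t⁺`, the kick response
of an observable `g` is `kickResp … N g t = ∫ p₀ · (K_t g) dμ₀` (`Theorems/PhononMeanFreePathDefs`, section
CoherentField). For the polynomial observables `g ∈ {p_x, q_x, q_x³, (q_{b+1} - q_b)³, V'(q_{b+1} - q_b)}` — all
continuous and `O(e^{ϑH})` for every `ϑ > 0` — this file proves, at FIXED `N`:

* CONTINUITY of `t ↦ kickResp g t` on `ℝ` (`pinnedChain_continuous_crossCorr`, file
  `PhononMeanFreePathCoherentDephasingCrossCorrelationContinuity`, with the weight `a = p₀`);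
* LINEARITY `F_b = (n_{b+1} - n_b) + β d_b` (`kickResp` is linear on the exponential class: every such observable
  is integrable for every `K_u(z, ·)`, and `p₀ · (K_u g) ∈ L¹(μ₀)`);
* EXPONENTIAL DECAY `|kickResp g t| ≤ C e^{-ct}` for `t ≥ 0` with ONE pair `(C, c)`, `c > 0`, for the whole finite
  family (`pinnedChain_corr_exp_decay`, i.e. CEHR 2018 Thm 2.13 (3) at fixed length, with the weight `a = p₀` of
  vanishing Gibbs mean; then `max` / `min` over the finite index set).

Main statement: `stub_responseRegularity` (the registered signature, verbatim). Nothing here is uniform in `N`.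
-/

noncomputable section

open MeasureTheory ProbabilityTheory Set
open Filter Topology
open scoped NNReal

namespace Summit.AtomisticToContinuum.FouriersLaw.Theorems.CoherentDephasing.ResponseRegularity

open Literature.MathematicalPhysics.KineticTheory.HeatConduction
open Summit.AtomisticToContinuum.FouriersLaw.Theorems.PhononMeanFreePath
open Literature.MathematicalPhysics.KineticTheory Literature.Probability.Process OscillatorChain
open Summit.AtomisticToContinuum.FouriersLaw.Theorems.SubdiffusiveBondHeat

/-! ### Elementary real inequalities: polynomial growth is dominated by `e^{ϑ h}` -/

/-- `|s| ≤ (1/2 + B/(2ϑ)) e^{ϑ h}` whenever `s² ≤ B h` with `h, B ≥ 0` and `ϑ > 0`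
(`|s| ≤ (1 + s²)/2`, `1 ≤ e^{ϑh}`, `h ≤ e^{ϑh}/ϑ`). [folklore] -/
theorem abs_le_exp_of_sq_le {s B h ϑ : ℝ} (hϑ : 0 < ϑ) (hB : 0 ≤ B) (hh : 0 ≤ h) (hs : s ^ 2 ≤ B * h) :
    |s| ≤ (1 / 2 + B / (2 * ϑ)) * Real.exp (ϑ * h) := by
  have hE1 : 1 ≤ Real.exp (ϑ * h) := Real.one_le_exp (by positivity)
  have hhle : h ≤ Real.exp (ϑ * h) / ϑ := by
    rw [le_div_iff₀ hϑ]; nlinarith [Real.add_one_le_exp (ϑ * h)]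
  have habs : |s| ≤ (1 + s ^ 2) / 2 := by
    rw [abs_le]; constructor <;> nlinarith [sq_nonneg (s + 1), sq_nonneg (s - 1)]
  calc |s| ≤ (1 + B * h) / 2 := by linarith
    _ ≤ (Real.exp (ϑ * h) + B * (Real.exp (ϑ * h) / ϑ)) / 2 := by gcongr
    _ = (1 / 2 + B / (2 * ϑ)) * Real.exp (ϑ * h) := by field_simp

/-- `|s³| ≤ (B/(2ϑ) + B²/ϑ²) e^{ϑ h}` whenever `s² ≤ B h` with `h, B ≥ 0` and `ϑ > 0`
(`|s³| ≤ (s² + s⁴)/2`, `h ≤ e^{ϑh}/ϑ`, `h² ≤ 2e^{ϑh}/ϑ²`). [folklore] -/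
theorem abs_cube_le_exp_of_sq_le {s B h ϑ : ℝ} (hϑ : 0 < ϑ) (hB : 0 ≤ B) (hh : 0 ≤ h) (hs : s ^ 2 ≤ B * h) :
    |s ^ 3| ≤ (B / (2 * ϑ) + B ^ 2 / ϑ ^ 2) * Real.exp (ϑ * h) := by
  have hhle : h ≤ Real.exp (ϑ * h) / ϑ := by
    rw [le_div_iff₀ hϑ]; nlinarith [Real.add_one_le_exp (ϑ * h)]
  have hh2le : h ^ 2 ≤ 2 * Real.exp (ϑ * h) / ϑ ^ 2 := by
    rw [le_div_iff₀ (by positivity)]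
    have := Real.quadratic_le_exp_of_nonneg (show 0 ≤ ϑ * h by positivity)
    nlinarith
  have habs : |s| ≤ (1 + s ^ 2) / 2 := by
    rw [abs_le]; constructor <;> nlinarith [sq_nonneg (s + 1), sq_nonneg (s - 1)]
  have h3 : |s ^ 3| = |s| * s ^ 2 := by
    rw [abs_pow, pow_succ, sq_abs]; ring
  calc |s ^ 3| = |s| * s ^ 2 := h3
    _ ≤ (1 + s ^ 2) / 2 * s ^ 2 := by gcongr
    _ = (s ^ 2 + (s ^ 2) ^ 2) / 2 := by ring
    _ ≤ (B * h + (B * h) ^ 2) / 2 := by gcongr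
    _ = (B * h + B ^ 2 * h ^ 2) / 2 := by ring
    _ ≤ (B * (Real.exp (ϑ * h) / ϑ) + B ^ 2 * (2 * Real.exp (ϑ * h) / ϑ ^ 2)) / 2 := by gcongr
    _ = (B / (2 * ϑ) + B ^ 2 / ϑ ^ 2) * Real.exp (ϑ * h) := by field_simp

/-! ### One pair of decay constants for a finite family -/

/-- A finite family of functions each bounded by `C_i e^{-c_i t}` on `t ≥ 0` (`c_i > 0`) is bounded by ONE
`C e^{-ct}` with `c > 0`: `C = max_i C_i`, `c = min_i c_i` (and `C = 0`, `c = 1` for the empty family).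
[folklore] -/
theorem exists_uniform_exp_decay {ι : Type*} [Finite ι] (F : ι → ℝ → ℝ)
    (h : ∀ i, ∃ C c : ℝ, 0 < c ∧ ∀ t : ℝ, 0 ≤ t → |F i t| ≤ C * Real.exp (-c * t)) :
    ∃ C c : ℝ, 0 < c ∧ ∀ t : ℝ, 0 ≤ t → ∀ i, |F i t| ≤ C * Real.exp (-c * t) := by
  choose C c hc hF using h
  cases isEmpty_or_nonempty ι with
  | inl _ => exact ⟨0, 1, one_pos, fun t _ i => isEmptyElim i⟩
  | inr _ =>
    haveI := Fintype.ofFinite ι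
    have hne : (Finset.univ : Finset ι).Nonempty := Finset.univ_nonempty
    refine ⟨Finset.univ.sup' hne C, Finset.univ.inf' hne c, (Finset.lt_inf'_iff hne).2 fun i _ => hc i,
      fun t ht i => ?_⟩
    have hC0 : 0 ≤ C i := by
      have h0 := hF i 0 le_rfl
      rw [mul_zero, Real.exp_zero, mul_one] at h0
      exact (abs_nonneg _).trans h0
    have hci : Finset.univ.inf' hne c ≤ c i := Finset.inf'_le c (Finset.mem_univ i)
    calc |F i t| ≤ C i * Real.exp (-c i * t) := hF i t ht
      _ ≤ C i * Real.exp (-Finset.univ.inf' hne c * t) :=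
          mul_le_mul_of_nonneg_left (Real.exp_le_exp.2 (by nlinarith)) hC0
      _ ≤ Finset.univ.sup' hne C * Real.exp (-Finset.univ.inf' hne c * t) :=
          mul_le_mul_of_nonneg_right (Finset.le_sup' C (Finset.mem_univ i)) (Real.exp_pos _).le

/-! ### The polynomial observables of the pinned chain are of exponential class -/

section Tame

variable {ω₂ lam β γ : ℝ} {n : ℕ}

/-- `q_j² ≤ (2/ω₂) H` and `0 ≤ H` for the pinned chain (`ω₂ > 0`, `lam, β ≥ 0`;
`H ≥ Σ p²/2 + ω₂ Σ q²/2`). [folklore] -/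
theorem sq_pos_le_hamiltonian (hω : 0 < ω₂) (hl : 0 ≤ lam) (hβ : 0 ≤ β) (z : PhaseSpace n) (j : Fin n) :
    z.1 j ^ 2 ≤ 2 / ω₂ * (pinnedChain ω₂ lam β γ).hamiltonian n z ∧
      0 ≤ (pinnedChain ω₂ lam β γ).hamiltonian n z := by
  have hH := pinnedChain_harmonic_le_hamiltonian (ω₂ := ω₂) hl hβ γ n z
  have h1 : 0 ≤ ∑ i, z.2 i ^ 2 / 2 := Finset.sum_nonneg fun i _ => by positivity
  have h2 : ω₂ * z.1 j ^ 2 / 2 ≤ ∑ i, ω₂ * z.1 i ^ 2 / 2 :=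
    Finset.single_le_sum (f := fun i => ω₂ * z.1 i ^ 2 / 2) (fun i _ => by positivity) (Finset.mem_univ _)
  have h3 : 0 ≤ ω₂ * z.1 j ^ 2 / 2 := by positivity
  constructor
  · rw [div_mul_eq_mul_div, le_div_iff₀ hω]; nlinarith
  · linarith

/-- `|q_j| ≤ M e^{ϑH}` for some `M`, for every `ϑ > 0`. [folklore] -/
theorem exists_abs_pos_le_exp (hω : 0 < ω₂) (hl : 0 ≤ lam) (hβ : 0 ≤ β) {ϑ : ℝ} (hϑ : 0 < ϑ) (j : Fin n) :
    ∃ M : ℝ, ∀ z : PhaseSpace n, |z.1 j| ≤ M * Real.exp (ϑ * (pinnedChain ω₂ lam β γ).hamiltonian n z) :=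
  ⟨_, fun z => abs_le_exp_of_sq_le hϑ (by positivity) (sq_pos_le_hamiltonian hω hl hβ z j).2
    (sq_pos_le_hamiltonian hω hl hβ z j).1⟩

/-- `|q_j³| ≤ M e^{ϑH}` for some `M`, for every `ϑ > 0`. [folklore] -/
theorem exists_abs_pos_cube_le_exp (hω : 0 < ω₂) (hl : 0 ≤ lam) (hβ : 0 ≤ β) {ϑ : ℝ} (hϑ : 0 < ϑ)
    (j : Fin n) :
    ∃ M : ℝ, ∀ z : PhaseSpace n, |z.1 j ^ 3| ≤ M * Real.exp (ϑ * (pinnedChain ω₂ lam β γ).hamiltonian n z) :=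
  ⟨_, fun z => abs_cube_le_exp_of_sq_le hϑ (by positivity) (sq_pos_le_hamiltonian hω hl hβ z j).2
    (sq_pos_le_hamiltonian hω hl hβ z j).1⟩

/-- `(q_i - q_j)² ≤ (8/ω₂) H` (`(a-b)² ≤ 2a² + 2b²`). [folklore] -/
theorem sq_stretch_le_hamiltonian (hω : 0 < ω₂) (hl : 0 ≤ lam) (hβ : 0 ≤ β) (z : PhaseSpace n)
    (i j : Fin n) :
    (z.1 i - z.1 j) ^ 2 ≤ 8 / ω₂ * (pinnedChain ω₂ lam β γ).hamiltonian n z := by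
  have hi := (sq_pos_le_hamiltonian (γ := γ) hω hl hβ z i).1
  have hj := (sq_pos_le_hamiltonian (γ := γ) hω hl hβ z j).1
  have h2 : (z.1 i - z.1 j) ^ 2 ≤ 2 * z.1 i ^ 2 + 2 * z.1 j ^ 2 := by
    nlinarith [sq_nonneg (z.1 i + z.1 j)]
  calc (z.1 i - z.1 j) ^ 2 ≤ 2 * z.1 i ^ 2 + 2 * z.1 j ^ 2 := h2
    _ ≤ 2 * (2 / ω₂ * (pinnedChain ω₂ lam β γ).hamiltonian n z) +
        2 * (2 / ω₂ * (pinnedChain ω₂ lam β γ).hamiltonian n z) := by gcongr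
    _ = 8 / ω₂ * (pinnedChain ω₂ lam β γ).hamiltonian n z := by ring

/-- `|(q_i - q_j)³| ≤ M e^{ϑH}` for some `M`, for every `ϑ > 0`. [folklore] -/
theorem exists_abs_stretch_cube_le_exp (hω : 0 < ω₂) (hl : 0 ≤ lam) (hβ : 0 ≤ β) {ϑ : ℝ} (hϑ : 0 < ϑ)
    (i j : Fin n) :
    ∃ M : ℝ, ∀ z : PhaseSpace n,
      |(z.1 i - z.1 j) ^ 3| ≤ M * Real.exp (ϑ * (pinnedChain ω₂ lam β γ).hamiltonian n z) :=
  ⟨_, fun z => abs_cube_le_exp_of_sq_le hϑ (by positivity) (sq_pos_le_hamiltonian hω hl hβ z j).2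
    (sq_stretch_le_hamiltonian hω hl hβ z i j)⟩

end Tame

/-! ### The kick response `t ↦ kickResp … N g t` of an observable of exponential class -/

section Kick

variable {ω₂ lam β γ T : ℝ}

/-- **Continuity and exponential decay of the kick response** of a continuous observable `g = O(e^{ϑH})`
(`0 < ϑ`, `2ϑ < 1/T`): `t ↦ kickResp … N g t = ∫ p₀ · (K_{t⁺} g) dμ₀` is continuous on `ℝ`
(`pinnedChain_continuous_crossCorr` with the weight `a = p₀`), and `|kickResp … N g t| ≤ C e^{-ct}` for `t ≥ 0`
with `c > 0` (`pinnedChain_corr_exp_decay`, CEHR 2018 Thm 2.13 (3) at fixed length, the Gibbs mean of the weight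
`p₀` being `0`). [folklore] -/
theorem continuous_kickResp_and_exp_decay (hω : 0 < ω₂) (hl : 0 ≤ lam) (hβ : 0 < β) (hγ : 0 < γ) (hT : 0 < T)
    (N : ℕ) {ϑ : ℝ} (hϑ0 : 0 < ϑ) (h2ϑ : 2 * ϑ < 1 / T) {g : PhaseSpace (N + 1) → ℝ} (hg : Continuous g)
    {Mg : ℝ} (hgM : ∀ y, |g y| ≤ Mg * Real.exp (ϑ * (pinnedChain ω₂ lam β γ).hamiltonian (N + 1) y)) :
    Continuous (kickResp ω₂ lam β γ T N g) ∧
      ∃ C c : ℝ, 0 < c ∧ ∀ t : ℝ, 0 ≤ t → |kickResp ω₂ lam β γ T N g t| ≤ C * Real.exp (-c * t) := by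
  have hN1 : 0 < N + 1 := N.succ_pos
  have ha : Continuous fun z : PhaseSpace (N + 1) => z.2 0 := by fun_prop
  have haM := fun y : PhaseSpace (N + 1) => abs_momentum_le_exp (γ := γ) hω.le hl hβ.le hϑ0 y 0
  refine ⟨pinnedChain_continuous_crossCorr _ _ _ _ hω hl hβ hγ _ hN1 _ hT _ hϑ0 h2ϑ _ _ ha hg _ _ haM hgM, ?_⟩
  obtain ⟨C, c, hc, h⟩ := pinnedChain_corr_exp_decay hω hl hβ hγ hN1 hT hϑ0 h2ϑ ha hg haM hgM
  refine ⟨C, c, hc, fun t ht => ?_⟩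
  have h' := h t ht
  rwa [pinnedChain_integral_momentum_gibbsMeasure, zero_mul, sub_zero] at h'

/-- **Linearity of the kick response** on the exponential class:
`kickResp (g₁ - g₂ + c g₃) = kickResp g₁ - kickResp g₂ + c · kickResp g₃` (every continuous `g = O(e^{ϑH})` is
integrable for every `K_u(z, ·)`, `N + 1 ≥ 1` sites, and `p₀ · (K_u g) ∈ L¹(μ₀)`). [folklore] -/
theorem kickResp_sub_add_const_mul (hω : 0 < ω₂) (hl : 0 ≤ lam) (hβ : 0 < β) (hγ : 0 < γ) (hT : 0 < T)
    (N : ℕ) {ϑ : ℝ} (hϑ0 : 0 < ϑ) (h2ϑ : 2 * ϑ < 1 / T) {g₁ g₂ g₃ : PhaseSpace (N + 1) → ℝ}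
    (hg₁ : Continuous g₁) (hg₂ : Continuous g₂) (hg₃ : Continuous g₃) {M₁ M₂ M₃ : ℝ}
    (hM₁ : ∀ y, |g₁ y| ≤ M₁ * Real.exp (ϑ * (pinnedChain ω₂ lam β γ).hamiltonian (N + 1) y))
    (hM₂ : ∀ y, |g₂ y| ≤ M₂ * Real.exp (ϑ * (pinnedChain ω₂ lam β γ).hamiltonian (N + 1) y))
    (hM₃ : ∀ y, |g₃ y| ≤ M₃ * Real.exp (ϑ * (pinnedChain ω₂ lam β γ).hamiltonian (N + 1) y)) (c t : ℝ) :
    kickResp ω₂ lam β γ T N (fun y => g₁ y - g₂ y + c * g₃ y) t =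
      kickResp ω₂ lam β γ T N g₁ t - kickResp ω₂ lam β γ T N g₂ t + c * kickResp ω₂ lam β γ T N g₃ t := by
  have hN1 : 0 < N + 1 := N.succ_pos
  have ha : Continuous fun z : PhaseSpace (N + 1) => z.2 0 := by fun_prop
  have haM := fun y : PhaseSpace (N + 1) => abs_momentum_le_exp (γ := γ) hω.le hl hβ.le hϑ0 y 0
  have hϑ1 : ϑ < 1 / T := by linarith
  -- `p₀ · (K_t gᵢ) ∈ L¹(μ₀)` and `gᵢ ∈ L¹(K_t(z, ·))`
  have hI₁ := pinnedChain_integrable_weight_mul_act hω hl hβ hγ hN1 hT hϑ0 h2ϑ ha hg₁ haM hM₁ t.toNNReal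
  have hI₂ := pinnedChain_integrable_weight_mul_act hω hl hβ hγ hN1 hT hϑ0 h2ϑ ha hg₂ haM hM₂ t.toNNReal
  have hI₃ := pinnedChain_integrable_weight_mul_act hω hl hβ hγ hN1 hT hϑ0 h2ϑ ha hg₃ haM hM₃ t.toNNReal
  have hexp := fun z => pinnedChain_integrable_exp_mul_hamiltonian_transitionKernel hω hl hT hβ.le hγ.le hN1
    hϑ0 hϑ1 t.toNNReal z
  have hκ₁ := fun z => integrable_of_abs_le_exp (hexp z) hg₁ hM₁
  have hκ₂ := fun z => integrable_of_abs_le_exp (hexp z) hg₂ hM₂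
  have hκ₃ := fun z => integrable_of_abs_le_exp (hexp z) hg₃ hM₃
  simp only [kickResp]
  rw [← integral_sub hI₁ hI₂, ← integral_const_mul c, ← integral_add (hI₁.sub' hI₂) (hI₃.const_mul c)]
  refine integral_congr_ae (Eventually.of_forall fun z => ?_)
  dsimp only
  rw [integral_add ((hκ₁ z).sub' (hκ₂ z)) ((hκ₃ z).const_mul c), integral_sub (hκ₁ z) (hκ₂ z),
    integral_const_mul]
  ring

end Kick

/-! ### The stub -/

/-- **Stub `stub_responseRegularity` of line `Sketch` (fixed `N`).** For `ω₂, lam, β, γ, T > 0` and every `N`,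
the coherent response field of the `(N+1)`-site chain satisfies: (i) `t ↦ m_x(t), n_x(t), c_x(t), d_b(t)` are
continuous on `ℝ`; (ii) `F_b(t) = n_{b+1}(t) - n_b(t) + β d_b(t)` for all `t`; (iii) there are `C` and `c > 0` with
`|m_x(t)|, |n_x(t)|, |c_x(t)|, |d_b(t)| ≤ C e^{-ct}` for all `t ≥ 0`, all sites `x` and bonds `b`. Proof: the
observables `p_x, q_x, q_x³, (q_{b+1} - q_b)³` are continuous and `O(e^{ϑH})` with `ϑ = 1/(4T)`; apply
`continuous_kickResp_and_exp_decay`, `kickResp_sub_add_const_mul`, and `exists_uniform_exp_decay` over the finite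
index set `Fin (N+1) ⊕ Fin (N+1) ⊕ Fin (N+1) ⊕ Fin N`. [folklore] -/
theorem stub_responseRegularity :
    ∀ ω₂ lam β γ : ℝ, 0 < ω₂ → 0 < lam → 0 < β → 0 < γ → ∀ T : ℝ, 0 < T → ∀ N : ℕ,
      (∀ x : Fin (N + 1), Continuous (momResp ω₂ lam β γ T N x) ∧ Continuous (posResp ω₂ lam β γ T N x) ∧
          Continuous (cubeResp ω₂ lam β γ T N x)) ∧
      (∀ b : Fin N, Continuous (stretchCubeResp ω₂ lam β γ T N b)) ∧
      (∀ (b : Fin N) (t : ℝ), bondForceResp ω₂ lam β γ T N b t =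
          posResp ω₂ lam β γ T N b.succ t - posResp ω₂ lam β γ T N b.castSucc t +
            β * stretchCubeResp ω₂ lam β γ T N b t) ∧
      (∃ C c : ℝ, 0 < c ∧ ∀ t : ℝ, 0 ≤ t →
          (∀ x : Fin (N + 1), |momResp ω₂ lam β γ T N x t| ≤ C * Real.exp (-c * t) ∧
              |posResp ω₂ lam β γ T N x t| ≤ C * Real.exp (-c * t) ∧
              |cubeResp ω₂ lam β γ T N x t| ≤ C * Real.exp (-c * t)) ∧
          (∀ b : Fin N, |stretchCubeResp ω₂ lam β γ T N b t| ≤ C * Real.exp (-c * t))) := by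
  intro ω₂ lam β γ hω hl hβ hγ T hT N
  -- the weight `ϑ = 1/(4T)`: `0 < ϑ`, `2ϑ < 1/T`
  set ϑ : ℝ := 1 / (4 * T) with hϑ
  have hϑ0 : 0 < ϑ := by positivity
  have h2ϑ : 2 * ϑ < 1 / T := by
    rw [hϑ, show 2 * (1 / (4 * T)) = 1 / (2 * T) by field_simp; ring, div_lt_div_iff₀ (by positivity) hT]
    nlinarith
  -- the observables are continuous and of exponential class
  have hmomc : ∀ x : Fin (N + 1), Continuous fun y : PhaseSpace (N + 1) => y.2 x := fun x => by fun_prop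
  have hposc : ∀ x : Fin (N + 1), Continuous fun y : PhaseSpace (N + 1) => y.1 x := fun x => by fun_prop
  have hcubec : ∀ x : Fin (N + 1), Continuous fun y : PhaseSpace (N + 1) => y.1 x ^ 3 := fun x => by fun_prop
  have hstrc : ∀ b : Fin N, Continuous fun y : PhaseSpace (N + 1) => (y.1 b.succ - y.1 b.castSucc) ^ 3 :=
    fun b => by fun_prop
  have hmomM := fun (x : Fin (N + 1)) (y : PhaseSpace (N + 1)) =>
    abs_momentum_le_exp (γ := γ) hω.le hl.le hβ.le hϑ0 y x
  -- continuity and decay, observable by observable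
  have Hmom := fun x : Fin (N + 1) =>
    continuous_kickResp_and_exp_decay hω hl.le hβ hγ hT N hϑ0 h2ϑ (hmomc x) (hmomM x)
  have Hpos : ∀ x : Fin (N + 1), Continuous (posResp ω₂ lam β γ T N x) ∧
      ∃ C c : ℝ, 0 < c ∧ ∀ t : ℝ, 0 ≤ t → |posResp ω₂ lam β γ T N x t| ≤ C * Real.exp (-c * t) := fun x => by
    obtain ⟨M, hM⟩ := exists_abs_pos_le_exp hω hl.le hβ.le (γ := γ) (n := N + 1) hϑ0 x
    exact continuous_kickResp_and_exp_decay hω hl.le hβ hγ hT N hϑ0 h2ϑ (hposc x) hM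
  have Hcube : ∀ x : Fin (N + 1), Continuous (cubeResp ω₂ lam β γ T N x) ∧
      ∃ C c : ℝ, 0 < c ∧ ∀ t : ℝ, 0 ≤ t → |cubeResp ω₂ lam β γ T N x t| ≤ C * Real.exp (-c * t) := fun x => by
    obtain ⟨M, hM⟩ := exists_abs_pos_cube_le_exp hω hl.le hβ.le (γ := γ) (n := N + 1) hϑ0 x
    exact continuous_kickResp_and_exp_decay hω hl.le hβ hγ hT N hϑ0 h2ϑ (hcubec x) hM
  have Hstr : ∀ b : Fin N, Continuous (stretchCubeResp ω₂ lam β γ T N b) ∧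
      ∃ C c : ℝ, 0 < c ∧ ∀ t : ℝ, 0 ≤ t →
        |stretchCubeResp ω₂ lam β γ T N b t| ≤ C * Real.exp (-c * t) := fun b => by
    obtain ⟨M, hM⟩ := exists_abs_stretch_cube_le_exp hω hl.le hβ.le (γ := γ) (n := N + 1) hϑ0
      b.succ b.castSucc
    exact continuous_kickResp_and_exp_decay hω hl.le hβ hγ hT N hϑ0 h2ϑ (hstrc b) hM
  refine ⟨fun x => ⟨(Hmom x).1, (Hpos x).1, (Hcube x).1⟩, fun b => (Hstr b).1, fun b t => ?_, ?_⟩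
  · -- linearity of the bond force response
    obtain ⟨M₁, hM₁⟩ := exists_abs_pos_le_exp hω hl.le hβ.le (γ := γ) (n := N + 1) hϑ0 b.succ
    obtain ⟨M₂, hM₂⟩ := exists_abs_pos_le_exp hω hl.le hβ.le (γ := γ) (n := N + 1) hϑ0 b.castSucc
    obtain ⟨M₃, hM₃⟩ := exists_abs_stretch_cube_le_exp hω hl.le hβ.le (γ := γ) (n := N + 1) hϑ0
      b.succ b.castSucc
    exact kickResp_sub_add_const_mul hω hl.le hβ hγ hT N hϑ0 h2ϑ (hposc b.succ) (hposc b.castSucc) (hstrc b)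
      hM₁ hM₂ hM₃ β t
  · -- one pair of decay constants for the whole finite family
    obtain ⟨C, c, hc, h⟩ := exists_uniform_exp_decay
      (Sum.elim (momResp ω₂ lam β γ T N) (Sum.elim (posResp ω₂ lam β γ T N)
        (Sum.elim (cubeResp ω₂ lam β γ T N) (stretchCubeResp ω₂ lam β γ T N))))
      (by rintro (x | x | x | b); exacts [(Hmom x).2, (Hpos x).2, (Hcube x).2, (Hstr b).2])
    exact ⟨C, c, hc, fun t ht => ⟨fun x => ⟨h t ht (Sum.inl x), h t ht (Sum.inr (Sum.inl x)),
      h t ht (Sum.inr (Sum.inr (Sum.inl x)))⟩, fun b => h t ht (Sum.inr (Sum.inr (Sum.inr b)))⟩⟩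

end Summit.AtomisticToContinuum.FouriersLaw.Theorems.CoherentDephasing.ResponseRegularity

end
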